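import Literature.Computability.AlgebraicComplexity.ValiantHCCompleteness
import Literature.Computability.AlgebraicComplexity.VNPClosedUnderDifferentiation
import Literature.Computability.AlgebraicComplexity.VNPClosedUnderSum
import Literature.Computability.AlgebraicComplexity.VPClosedUnderSum
import Literature.Computability.AlgebraicComplexity.FormulaUnfolding
import HarnessLib

/-!
# `VP` and `VNP` are closed under composition (Bürgisser 2024 survey, §3.1) — PROVED over every
# field (the `VNP ∘ VNP` case through Valiant's `VNP`-completeness of `HC`)

Topic `Computability/AlgebraicComplexity`. Cell `val-lit`, row Bur2024-A (Bürgisser 2024 survey,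
arXiv:2406.06217), §3.1 "Robustness" (held text `paper:arxiv-2406.06217`, p0013 L10–L15):

> It is easy to see that all the complexity classes introduced before are closed under
> `p`-projections and with respect to several natural operations, such as taking sums, products,
> or compositions. The latter means forming `(f_n(g_1, …, g_{v(n)}))` from sequences `(f_n)` and
> `(g_n)`, where `f_n ∈ 𝔽[x_1, …, x_{v(n)}]`.

The tree has the closure of `VP` / `VNP` under `p`-projections, sums and products
(`ValiantClasses.lean`, `VPClosedUnderSum.lean`, `VNPClosedUnderSum.lean`,
`VNPClosedUnderProjection.lean`) and composition at the level of single CIRCUITS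
(`ArithCircuitComposition.lean`, `complexity_aeval_le` of `IMMInVPProofs.lean`), but not the
family-level closure under composition. This file proves it, in the tree's currency of families
`f : ∀ n, MvPolynomial (σ n) k` (`IsVPFamily`, `IsVNPFamily` of `ValiantClasses.lean`):

* **substitution form** (the usable statement): for an outer family `(f_n)`, `f_n ∈ k[ρ_n]`, and
  inner TUPLES `g_n = (g_{n,i})_{i ∈ ρ_n}` of polynomials in `k[τ_n]` with `#τ_n`, `max_i deg g_{n,i}`
  and `Σ_i L(g_{n,i})` p-bounded, the composite `(f_n(g_n))_n = (aeval g_n f_n)_n` is in `VP` if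
  `(f_n) ∈ VP` (`IsVPFamily.aeval`), and in `VNP` if `(f_n) ∈ VNP` (`IsVNPFamily.aeval`); and if the
  inner tuple is only uniformly `p`-DEFINABLE, `g_{n,i} = Σ_{e ∈ {0,1}^{u(n,i)}} G_{n,i}(X, e)` with
  `VP`-type bounds on the `G_{n,i}`, the composite of a `VNP` family is still in `VNP`
  (**`isVNPFamily_aeval_boolSum`**);
* **the survey's literal form**: for `p`-families `(f_n)`, `f_n ∈ k[X_0, …, X_{v(n)-1}]`, and
  `(g_n)`, `g_n ∈ k[X_0, …, X_{w(n)-1}]`, the composite `(f_n(g_0, …, g_{v(n)-1}))_n` (the inner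
  members embedded in a common `k[X_0, …, X_{W(n)-1}]`, `W` p-bounded) is in `VP`, resp. `VNP`,
  when both families are (`IsVPFamily.comp`, **`IsVNPFamily.comp`**). (The tree indexes families
  and variables from `0`; the survey's `g_1, …, g_{v(n)}` become `g_0, …, g_{v(n)-1}`.)

Proofs. `VP`: juxtapose circuits (`complexity_aeval_le`: `L(f(g)) ≤ L(f) + Σ_i L(g_i)`) and
`deg f(g) ≤ deg f · max deg g_i`. `VNP` with `VP` inner tuple: substitute into the `VP` witness,
Boolean summation commutes with substitution of the free variables (`boolSum_aeval_extend`).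
`VNP` with `VNP` inner tuple — the only case that is not immediate (a circuit for the outer
witness would re-use the inner Boolean sums; exchanging `Π` and `Σ_e` is only affordable along a
SUM OF PRODUCTS): by Valiant's completeness of the Hamiltonian cycle family over every field
(`isVNPComplete_hcPoly_holds`, `ValiantHCCompleteness.lean`), `f_n = HC_{t(n)}(a_n)` is a projection
of `HC`, so `f_n(g) = HC_t(b)` with entries `b_q ∈ {g_{n,i}} ∪ k`, each a Boolean sum
`b_q = Σ_e B_q(X, e)` over ONE common block size `u` (constants padded: `c = Σ_e c·∏_l e_l`,
`boolSum_C_mul_prod_X`); then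
`HC_t(b) = Σ_π ∏_i Σ_{e_i} B_{π i, i}(X, e_i) = Σ_{(e_i)_i} Σ_π ∏_i B_{π i,i}(X, e_i) = Σ_E HC_t(B̃(X, E))`
with one Boolean block per COLUMN `i` (`prod_boolSum`, `aeval_boolSum_sum_prod_X`,
`aeval_boolSum_hcPoly`), and `(HC_{t(n)}(B̃_n))_n ∈ VNP` by the `VP`-inner case applied to the
reindexed family `(HC_{t(n)})_n` (`IsVNPFamily.reindex`, `IsVNPFamily.aeval`), whence the Boolean
sum is in `VNP` (`IsVNPFamily.boolSum`). Non-uniform block sizes are first padded to the maximum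
(`boolSum_pad`).

Contents: `IsVPFamily.reindex`, `IsVNPFamily.reindex` · `IsVPFamily.aeval`, `IsVNPFamily.aeval` ·
`boolSum_add'`, `boolSum_finset_sum`, `prod_boolSum`, `boolSum_C_mul_prod_X`, `boolSum_pad`,
`aeval_boolSum_sum_prod_X`, `aeval_boolSum_hcPoly` · `isVNPFamily_aeval_boolSum_uniform`,
**`isVNPFamily_aeval_boolSum`** · `IsPBounded.sup_fin`, `IsPBounded.sum_fin`, `IsVPFamily.comp`,
**`IsVNPFamily.comp`** · (`VF = VP_e`, p-bounded formula size) `isPBounded_formulaComplexity_aeval`,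
`isPBounded_formulaComplexity_comp`.

Theorems only; 0 definitions, 0 named facts. Scope: `IsVPFamily.aeval` over commutative rings;
the `VNP` statements over fields (the tree's `HC`-completeness is stated for fields), ANY
characteristic; `VF = VP_e` (rendered, as elsewhere in the tree, by `IsPBounded (E ∘ f)`) over
commutative semirings via `formulaComplexity_bind₁_le` (`FormulaUnfolding.lean`). `VBP = VP_ws`
(also covered by the survey's sentence) is not treated here. Honest framing: closure bookkeeping of Valiant's classes; nothing here bears on
`VP` versus `VNP`; `VP ≠ VNP` is NOT proved.

## References

* [Burgisser2024Completeness] P. Bürgisser, *Completeness classes in algebraic complexity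
  theory*, arXiv:2406.06217 (2024), §3.1 (p0013 L10–L15).
* [Burgisser2000] P. Bürgisser, *Completeness and Reduction in Algebraic Complexity Theory*,
  Springer 2000, Def. 2.1, Def. 2.5, Rem. 2.7, Thm. 2.10.
* [vonzurGathen1987] J. von zur Gathen, *Feasible arithmetic computations: Valiant's hypothesis*,
  J. Symbolic Comput. 4 (1987) 137–172, Thm. 5.6 (`HC` is p-complete over any field).
-/

noncomputable section

open MvPolynomial

namespace Literature.Computability.AlgebraicComplexity

universe u v w

/-! ## Degree of a substitution; reindexing families along p-bounded functions -/

section Helpers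

variable {k : Type u} [CommSemiring k]

/-- Degree of a substitution: if every `θ i` has total degree `≤ δ` then
`deg f(θ) ≤ (deg f) · δ`. [cite: Burgisser2000, Rem. 2.7] -/
theorem totalDegree_aeval_le_mul_of_le {ι : Type v} {κ : Type w} (θ : ι → MvPolynomial κ k)
    (δ : ℕ) (hθ : ∀ i, (θ i).totalDegree ≤ δ) (p : MvPolynomial ι k) :
    (aeval θ p).totalDegree ≤ p.totalDegree * δ := by
  classical
  conv_lhs => rw [p.as_sum]
  rw [map_sum]
  refine (totalDegree_finsetSum _ _).trans (Finset.sup_le fun d hd => ?_)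
  rw [aeval_monomial, ← C_eq_algebraMap]
  refine (totalDegree_mul _ _).trans ?_
  rw [totalDegree_C, zero_add]
  refine (totalDegree_finsetProd _ _).trans ?_
  calc ∑ i ∈ d.support, (θ i ^ d i).totalDegree
      ≤ ∑ i ∈ d.support, d i * δ :=
        Finset.sum_le_sum fun i _ => (totalDegree_pow _ _).trans (Nat.mul_le_mul_left _ (hθ i))
    _ = (d.sum fun _ e => e) * δ := by rw [Finsupp.sum, Finset.sum_mul]
    _ ≤ p.totalDegree * δ := Nat.mul_le_mul_right _ (le_totalDegree hd)

variable {σ : ℕ → Type v} [∀ n, Fintype (σ n)]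

/-- Reindexing a `VP` family along a p-bounded function `t` gives a `VP` family `(f_{t(n)})_n`
(p-bounded functions are closed under composition, Bürgisser 2000 Def. 2.1).
[cite: Burgisser2000, Def. 2.1(1)] -/
theorem IsVPFamily.reindex {f : ∀ n, MvPolynomial (σ n) k} (hf : IsVPFamily f) {t : ℕ → ℕ}
    (ht : IsPBounded t) : IsVPFamily (σ := fun n => σ (t n)) fun n => f (t n) := by
  obtain ⟨⟨hv, hd⟩, hc⟩ := hf
  exact ⟨⟨IsPBounded.comp_holds hv ht, IsPBounded.comp_holds hd ht⟩, IsPBounded.comp_holds hc ht⟩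

/-- Reindexing a `VNP` family along a p-bounded function `t` gives a `VNP` family `(f_{t(n)})_n`.
[cite: Burgisser2000, Def. 2.1(1) and Def. 2.5] -/
theorem IsVNPFamily.reindex {f : ∀ n, MvPolynomial (σ n) k} (hf : IsVNPFamily f) {t : ℕ → ℕ}
    (ht : IsPBounded t) : IsVNPFamily (σ := fun n => σ (t n)) fun n => f (t n) := by
  obtain ⟨⟨hv, hd⟩, u, g, ⟨⟨gv, gd⟩, gc⟩, hfg⟩ := hf
  exact ⟨⟨IsPBounded.comp_holds hv ht, IsPBounded.comp_holds hd ht⟩, fun n => u (t n),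
    fun n => g (t n), ⟨⟨IsPBounded.comp_holds gv ht, IsPBounded.comp_holds gd ht⟩,
      IsPBounded.comp_holds gc ht⟩, fun n => hfg (t n)⟩

end Helpers

/-! ## `VP` and `VNP` are closed under substitution of uniformly p-computable tuples -/

section Substitution

variable {k : Type u} [CommRing k] {ρ : ℕ → Type v} {τ : ℕ → Type w} [∀ n, Fintype (ρ n)]
  [∀ n, Fintype (τ n)]

/-- **`VP` is closed under composition** (substitution form; Bürgisser 2024, §3.1): if
`(f_n) ∈ VP`, `f_n ∈ k[ρ_n]`, and `g_n = (g_{n,i})_{i ∈ ρ_n}` are tuples of polynomials in `k[τ_n]`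
with `#τ_n`, `max_i deg g_{n,i}` and `Σ_i L(g_{n,i})` p-bounded, then `(f_n(g_n))_n ∈ VP`:
`L(f(g)) ≤ L(f) + Σ_i L(g_i)` (juxtaposed circuits, `complexity_aeval_le`) and
`deg f(g) ≤ deg f · max_i deg g_i`. [cite: Burgisser2024Completeness, §3.1 (p0013 L10–L15)] -/
theorem IsVPFamily.aeval {f : ∀ n, MvPolynomial (ρ n) k} (hf : IsVPFamily f)
    (g : ∀ n, ρ n → MvPolynomial (τ n) k) (hτ : IsPBounded fun n => Fintype.card (τ n))
    (hgd : IsPBounded fun n => Finset.univ.sup fun i => (g n i).totalDegree)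
    (hgc : IsPBounded fun n => ∑ i, complexity (g n i)) :
    IsVPFamily fun n => MvPolynomial.aeval (g n) (f n) := by
  obtain ⟨⟨_, hd⟩, hc⟩ := hf
  refine ⟨⟨hτ, (IsPBounded.mul_holds hd hgd).mono fun n => ?_⟩,
    (IsPBounded.add_holds hc hgc).mono fun n => complexity_aeval_le (f n) (g n)⟩
  exact totalDegree_aeval_le_mul_of_le _ _
    (fun i => Finset.le_sup (f := fun i => (g n i).totalDegree) (Finset.mem_univ i)) _

/-- **`VNP` is closed under composition with uniformly p-computable tuples** (Bürgisser 2024,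
§3.1): if `(f_n) ∈ VNP` and the tuples `g_n` are as in `IsVPFamily.aeval`, then
`(f_n(g_n))_n ∈ VNP` — substitute into the `VP` witness; the Boolean sum commutes with the
substitution of the free variables (`boolSum_aeval_extend`). [cite: Burgisser2024Completeness, §3.1 (p0013 L10–L15)] -/
theorem IsVNPFamily.aeval {f : ∀ n, MvPolynomial (ρ n) k} (hf : IsVNPFamily f)
    (g : ∀ n, ρ n → MvPolynomial (τ n) k) (hτ : IsPBounded fun n => Fintype.card (τ n))
    (hgd : IsPBounded fun n => Finset.univ.sup fun i => (g n i).totalDegree)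
    (hgc : IsPBounded fun n => ∑ i, complexity (g n i)) :
    IsVNPFamily fun n => MvPolynomial.aeval (g n) (f n) := by
  classical
  obtain ⟨⟨hv, hd⟩, u, G, hG, hfG⟩ := hf
  have hu : IsPBounded u := hG.1.1.mono fun n => by simp [Fintype.card_sum]
  -- the extended inner tuples `(g_n, e)` on `ρ_n ⊔ Fin (u n)`
  let θ : ∀ n, (ρ n ⊕ Fin (u n)) → MvPolynomial (τ n ⊕ Fin (u n)) k := fun n =>
    Sum.elim (fun i => rename Sum.inl (g n i)) (fun j => X (Sum.inr j))
  have hθ : IsVPFamily fun n => MvPolynomial.aeval (θ n) (G n) := by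
    refine IsVPFamily.aeval hG θ ((IsPBounded.add_holds hτ hu).mono fun n => by simp)
      ((IsPBounded.add_holds hgd (IsPBounded.const 1)).mono fun n => ?_)
      (hgc.mono fun n => ?_)
    · refine Finset.sup_le fun x _ => ?_
      rcases x with i | j
      · exact (totalDegree_rename_le _ _).trans (le_add_right
          (Finset.le_sup (f := fun i => (g n i).totalDegree) (Finset.mem_univ i)))
      · exact (mvPolynomial_totalDegree_X_le_one _).trans (Nat.le_add_left _ _)
    · rw [Fintype.sum_sum_type]
      have h2 : ∑ j : Fin (u n), complexity (θ n (Sum.inr j)) = 0 :=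
        Finset.sum_eq_zero fun j _ => complexity_X_holds _
      rw [h2, add_zero]
      exact Finset.sum_le_sum fun i _ => complexity_rename_le_holds' _ _
  refine ⟨⟨hτ, (IsPBounded.mul_holds hd hgd).mono fun n => totalDegree_aeval_le_mul_of_le _ _
      (fun i => Finset.le_sup (f := fun i => (g n i).totalDegree) (Finset.mem_univ i)) _⟩,
    u, fun n => MvPolynomial.aeval (θ n) (G n), hθ, fun n => ?_⟩
  beta_reduce
  rw [hfG n, boolSum_aeval_extend]

end Substitution

/-! ## Boolean sums: additivity, products over independent blocks, padding -/

section BoolSumAlgebra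

variable {k : Type u} [CommSemiring k] {τ : Type v}

/-- Valiant's Boolean sum is additive. [cite: Burgisser2000, Def. 2.5] -/
theorem boolSum_add' {m : ℕ} (p q : MvPolynomial (τ ⊕ Fin m) k) :
    boolSum (p + q) = boolSum p + boolSum q := by
  unfold boolSum
  rw [← Finset.sum_add_distrib]
  exact Finset.sum_congr rfl fun e _ => map_add _ _ _

/-- Valiant's Boolean sum commutes with finite sums. [cite: Burgisser2000, Def. 2.5] -/
theorem boolSum_finset_sum {ι : Type w} {m : ℕ} (s : Finset ι)
    (p : ι → MvPolynomial (τ ⊕ Fin m) k) :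
    boolSum (∑ i ∈ s, p i) = ∑ i ∈ s, boolSum (p i) := by
  unfold boolSum
  simp only [map_sum]
  exact Finset.sum_comm

/-- **A product of Boolean sums is ONE Boolean sum over independent blocks**:
`∏_i Σ_{e ∈ {0,1}^u} P_i(X, e) = Σ_{E ∈ {0,1}^{t·u}} ∏_i P_i(X, E_i)`, the `i`-th factor reading
the `i`-th block `E_i = (E_{(i,l)})_l` of `E` (blocks placed by `finProdFinEquiv`).
[cite: Burgisser2000, Def. 2.5] -/
theorem prod_boolSum {t u : ℕ} (P : Fin t → MvPolynomial (τ ⊕ Fin u) k) :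
    ∏ i, boolSum (P i) =
      boolSum (∏ i, rename (Sum.map id fun l : Fin u => finProdFinEquiv (i, l)) (P i)) := by
  classical
  unfold boolSum
  have hR : ∀ E : Fin (t * u) → Bool,
      MvPolynomial.aeval (Sum.elim X fun j => if E j then (1 : MvPolynomial τ k) else 0)
        (∏ i, rename (Sum.map id fun l : Fin u => finProdFinEquiv (i, l)) (P i)) =
      ∏ i, MvPolynomial.aeval
        (Sum.elim X fun l => if E (finProdFinEquiv (i, l)) then (1 : MvPolynomial τ k) else 0)
        (P i) := by
    intro E
    rw [map_prod]
    refine Finset.prod_congr rfl fun i _ => ?_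
    rw [aeval_rename]
    have hfun : ((Sum.elim X fun j => if E j then (1 : MvPolynomial τ k) else 0) ∘
        Sum.map id fun l : Fin u => finProdFinEquiv (i, l)) =
        Sum.elim X fun l => if E (finProdFinEquiv (i, l)) then (1 : MvPolynomial τ k) else 0 := by
      funext x
      rcases x with a | l <;> rfl
    rw [hfun]
  simp only [hR]
  rw [Fintype.prod_sum]
  refine Fintype.sum_equiv (((Equiv.curry (Fin t) (Fin u) Bool).symm.trans
    (finProdFinEquiv.arrowCongr (Equiv.refl Bool)))) _ _ fun x => ?_
  refine Finset.prod_congr rfl fun i _ => ?_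
  have hfun : (Sum.elim X fun j => if x i j then (1 : MvPolynomial τ k) else 0) =
      Sum.elim X fun l => if ((Equiv.curry (Fin t) (Fin u) Bool).symm.trans
        (finProdFinEquiv.arrowCongr (Equiv.refl Bool))) x (finProdFinEquiv (i, l)) then
          (1 : MvPolynomial τ k) else 0 := by
    funext y
    rcases y with a | l
    · rfl
    · simp [Equiv.arrowCongr_apply, Function.uncurry]
  rw [hfun]

/-- **Padding a constant**: `Σ_{e ∈ {0,1}^u} c · ∏_l e_l = c` (only `e ≡ 1` contributes).
[cite: Burgisser2000, Def. 2.5] -/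
theorem boolSum_C_mul_prod_X {u : ℕ} (c : k) :
    boolSum (C c * ∏ l : Fin u, X (Sum.inr l) : MvPolynomial (τ ⊕ Fin u) k) = C c := by
  classical
  unfold boolSum
  have h : ∀ e : Fin u → Bool,
      MvPolynomial.aeval (Sum.elim X fun j => if e j then (1 : MvPolynomial τ k) else 0)
        (C c * ∏ l : Fin u, X (Sum.inr l) : MvPolynomial (τ ⊕ Fin u) k) =
      C c * ∏ l, (if e l then (1 : MvPolynomial τ k) else 0) := by
    intro e
    rw [map_mul, map_prod, algHom_C, algebraMap_eq]
    exact congrArg _ (Finset.prod_congr rfl fun l _ => by rw [aeval_X]; rfl)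
  simp only [h]
  rw [← Finset.mul_sum]
  have hps : (∑ e : Fin u → Bool, ∏ l, (if e l then (1 : MvPolynomial τ k) else 0)) =
      ∏ _l : Fin u, ∑ b : Bool, (if b then (1 : MvPolynomial τ k) else 0) :=
    (Fintype.prod_sum fun (_ : Fin u) (b : Bool) => if b then (1 : MvPolynomial τ k) else 0).symm
  rw [hps, Fintype.sum_bool, if_pos rfl, if_neg Bool.false_ne_true, add_zero,
    Finset.prod_const_one, mul_one]

/-- **Padding a Boolean sum to a larger block**: for `u ≤ U`,
`Σ_{E ∈ {0,1}^U} G(X, E_{<u}) · ∏_{l ≥ u} E_l = Σ_{e ∈ {0,1}^u} G(X, e)` (only the assignments with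
`E_l = 1` for all `l ≥ u` contribute). [cite: Burgisser2000, Def. 2.5] -/
theorem boolSum_pad {u U : ℕ} (h : u ≤ U) (G : MvPolynomial (τ ⊕ Fin u) k) :
    boolSum (rename (Sum.map id (Fin.castLE h)) G *
      ∏ l ∈ Finset.univ.filter (fun l : Fin U => u ≤ (l : ℕ)), X (Sum.inr l)) = boolSum G := by
  classical
  unfold boolSum
  set S : Finset (Fin U) := Finset.univ.filter (fun l : Fin U => u ≤ (l : ℕ)) with hS
  have hev : ∀ E : Fin U → Bool,
      MvPolynomial.aeval (Sum.elim X fun j => if E j then (1 : MvPolynomial τ k) else 0)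
        (rename (Sum.map id (Fin.castLE h)) G * ∏ l ∈ S, X (Sum.inr l)) =
      MvPolynomial.aeval
          (Sum.elim X fun j => if E (Fin.castLE h j) then (1 : MvPolynomial τ k) else 0) G *
        ∏ l ∈ S, (if E l then (1 : MvPolynomial τ k) else 0) := by
    intro E
    rw [map_mul, map_prod, aeval_rename]
    have hfun : ((Sum.elim X fun j => if E j then (1 : MvPolynomial τ k) else 0) ∘
        Sum.map id (Fin.castLE h)) =
        Sum.elim X fun j => if E (Fin.castLE h j) then (1 : MvPolynomial τ k) else 0 := by
      funext x
      rcases x with a | j <;> rfl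
    rw [hfun]
    exact congrArg _ (Finset.prod_congr rfl fun l _ => by rw [aeval_X]; rfl)
  simp only [hev]
  set T : Finset (Fin U → Bool) := Finset.univ.filter fun E => ∀ l ∈ S, E l = true with hT
  have hzero : ∀ E ∉ T, (∏ l ∈ S, (if E l then (1 : MvPolynomial τ k) else 0)) = 0 := by
    intro E hE
    simp only [hT, Finset.mem_filter, Finset.mem_univ, true_and, not_forall] at hE
    obtain ⟨l, hl, hEl⟩ := hE
    exact Finset.prod_eq_zero hl (by rw [if_neg hEl])
  have hone : ∀ E ∈ T, (∏ l ∈ S, (if E l then (1 : MvPolynomial τ k) else 0)) = 1 := by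
    intro E hE
    simp only [hT, Finset.mem_filter, Finset.mem_univ, true_and] at hE
    exact Finset.prod_eq_one fun l hl => by rw [if_pos (hE l hl)]
  rw [← Finset.sum_subset (Finset.subset_univ T) fun E _ hE => by rw [hzero E hE, mul_zero]]
  have hmemS : ∀ l : Fin U, l ∈ S ↔ u ≤ (l : ℕ) := fun l => by simp [hS]
  refine Finset.sum_bij' (fun E _ => E ∘ Fin.castLE h)
    (fun e _ => fun l => if hl : (l : ℕ) < u then e ⟨l, hl⟩ else true)
    (fun _ _ => Finset.mem_univ _) (fun e _ => ?_) (fun E hE => ?_) (fun e _ => ?_) (fun E hE => ?_)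
  · simp only [hT, Finset.mem_filter, Finset.mem_univ, true_and]
    intro l hl
    rw [dif_neg (not_lt.2 ((hmemS l).1 hl))]
  · funext l
    by_cases hl : (l : ℕ) < u
    · rw [dif_pos hl]
      exact congrArg E (Fin.ext rfl)
    · rw [dif_neg hl]
      simp only [hT, Finset.mem_filter, Finset.mem_univ, true_and] at hE
      exact (hE l ((hmemS l).2 (not_lt.1 hl))).symm
  · funext j
    simp only [Function.comp_apply, Fin.val_castLE, Fin.is_lt, dif_pos, Fin.eta]
  · rw [hone E hE, mul_one]
    rfl

/-- **Substituting Boolean sums into a sum of products of variables** `Σ_{π ∈ S} ∏_i X_{π i, i}`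
(the shape of `PER` and `HC`): with one Boolean block per column `i`,
`(Σ_π ∏_i b_{π i, i})` for `b_q = Σ_e B_q(X, e)` equals `Σ_E (Σ_π ∏_i B̃_{π i, i}(X, E))`,
`B̃_q = B_q` reading the block of its column `q.2`. [cite: Burgisser2000, Def. 2.5 and (2.3)] -/
theorem aeval_boolSum_sum_prod_X {t u : ℕ} (S : Finset (Equiv.Perm (Fin t)))
    (B : Fin t × Fin t → MvPolynomial (τ ⊕ Fin u) k) :
    MvPolynomial.aeval (fun q => boolSum (B q))
        (∑ π ∈ S, ∏ i, (X (π i, i) : MvPolynomial (Fin t × Fin t) k)) =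
      boolSum (MvPolynomial.aeval
        (fun q : Fin t × Fin t => rename (Sum.map id fun l : Fin u => finProdFinEquiv (q.2, l)) (B q))
        (∑ π ∈ S, ∏ i, (X (π i, i) : MvPolynomial (Fin t × Fin t) k))) := by
  rw [map_sum, map_sum, boolSum_finset_sum]
  refine Finset.sum_congr rfl fun π _ => ?_
  rw [map_prod, map_prod]
  simp only [aeval_X]
  exact prod_boolSum fun i => B (π i, i)

/-- The case `S` = Hamiltonian cycles: `HC_t(b) = Σ_E HC_t(B̃(X, E))` for entries
`b_q = Σ_e B_q(X, e)` with a common block size. [cite: Burgisser2000, (2.3) and Def. 2.5] -/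
theorem aeval_boolSum_hcPoly {t u : ℕ} (B : Fin t × Fin t → MvPolynomial (τ ⊕ Fin u) k) :
    MvPolynomial.aeval (fun q => boolSum (B q)) (hcPoly (Fin t) k) =
      boolSum (MvPolynomial.aeval
        (fun q : Fin t × Fin t => rename (Sum.map id fun l : Fin u => finProdFinEquiv (q.2, l)) (B q))
        (hcPoly (Fin t) k)) :=
  aeval_boolSum_sum_prod_X _ B

end BoolSumAlgebra

/-! ## `VNP` is closed under substitution of uniformly p-definable tuples (`VNP ∘ VNP`) -/

section Definable

variable {k : Type u} [Field k] {ρ : ℕ → Type v} {τ : ℕ → Type w} [∀ n, Fintype (ρ n)]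
  [∀ n, Fintype (τ n)] [∀ n, DecidableEq (τ n)]

/-- **`VNP ∘ VNP ⊆ VNP`, uniform block size** (Bürgisser 2024, §3.1; through Valiant's
`HC`-completeness): if `(f_n) ∈ VNP`, `f_n ∈ k[ρ_n]`, and `g_{n,i} = Σ_{e ∈ {0,1}^{u(n)}} G_{n,i}(X, e)`
with `#τ_n`, `u(n)`, `max_i deg G_{n,i}`, `Σ_i L(G_{n,i})` p-bounded, then `(f_n(g_n))_n ∈ VNP`.
Proof: `f_n = HC_{t(n)}(a_n)` (`isVNPComplete_hcPoly_holds`), each substituted entry is a Boolean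
sum over the common block (`boolSum_C_mul_prod_X` for the constants), `HC_t` of Boolean sums is a
Boolean sum of `HC_t(B̃)` (`aeval_boolSum_hcPoly`), `(HC_{t(n)}(B̃_n))_n ∈ VNP`
(`IsVNPFamily.reindex`, `IsVNPFamily.aeval`), and `VNP` is closed under Boolean sums
(`IsVNPFamily.boolSum`). [cite: Burgisser2024Completeness, §3.1 (p0013 L10–L15)] [cite: Burgisser2000, Thm. 2.10] -/
theorem isVNPFamily_aeval_boolSum_uniform {f : ∀ n, MvPolynomial (ρ n) k} (hf : IsVNPFamily f)
    {u : ℕ → ℕ} (G : ∀ n, ρ n → MvPolynomial (τ n ⊕ Fin (u n)) k)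
    (hτ : IsPBounded fun n => Fintype.card (τ n)) (hu : IsPBounded u)
    (hGd : IsPBounded fun n => Finset.univ.sup fun i => (G n i).totalDegree)
    (hGc : IsPBounded fun n => ∑ i, complexity (G n i)) :
    IsVNPFamily fun n => MvPolynomial.aeval (fun i => boolSum (G n i)) (f n) := by
  classical
  have hρ : IsPBounded fun n => Fintype.card (ρ n) := hf.1.1
  -- Step 1: rename the outer variables to `Fin (v n)`
  let e : ∀ n, ρ n ≃ Fin (Fintype.card (ρ n)) := fun n => Fintype.equivFin (ρ n)
  have hf' : IsVNPFamily fun n => rename (e n) (f n) := by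
    have h := IsVNPFamily.renameEquiv e hf
    refine (iff_of_eq (congrArg IsVNPFamily (funext fun n => ?_))).1 h
    rw [renameEquiv_apply]
  -- Step 2: `HC`-completeness
  obtain ⟨t, ht, hproj⟩ :=
    (isVNPComplete_hcPoly_holds k).2 (fun n => Fintype.card (ρ n)) (fun n => rename (e n) (f n)) hf'
  choose a ha hfa using hproj
  -- the substituted inner tuple, indexed by `Fin (v n)`
  let g' : ∀ n, Fin (Fintype.card (ρ n)) → MvPolynomial (τ n) k :=
    fun n j => boolSum (G n ((e n).symm j))
  -- Step 3: uniform Boolean-sum witnesses for the entries `b_q = (a_n q)(g')`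
  have hB : ∀ n (q : Fin (t n) × Fin (t n)), ∃ B : MvPolynomial (τ n ⊕ Fin (u n)) k,
      boolSum B = MvPolynomial.aeval (g' n) (a n q) ∧
      B.totalDegree ≤ (Finset.univ.sup fun i => (G n i).totalDegree) + u n ∧
      complexity B ≤ (∑ i, complexity (G n i)) + (u n + 1) := by
    intro n q
    rcases ha n q with ⟨j, hj⟩ | ⟨c, hc⟩
    · refine ⟨G n ((e n).symm j), ?_, ?_, ?_⟩
      · rw [hj, aeval_X]
      · exact le_add_right (Finset.le_sup (f := fun i => (G n i).totalDegree) (Finset.mem_univ _))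
      · exact le_add_right (Finset.single_le_sum (f := fun i => complexity (G n i))
          (fun _ _ => Nat.zero_le _) (Finset.mem_univ _))
    · refine ⟨C c * ∏ l : Fin (u n), X (Sum.inr l), ?_, ?_, ?_⟩
      · rw [hc, algHom_C, algebraMap_eq]
        exact boolSum_C_mul_prod_X c
      · refine (totalDegree_mul _ _).trans ?_
        rw [totalDegree_C, zero_add]
        refine (totalDegree_finsetProd _ _).trans ?_
        refine (Finset.sum_le_sum fun l _ => mvPolynomial_totalDegree_X_le_one (Sum.inr l)).trans ?_
        rw [Finset.sum_const, Finset.card_univ, Fintype.card_fin, smul_eq_mul, mul_one]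
        exact Nat.le_add_left _ _
      · refine (complexity_mul_le_holds _ _).trans ?_
        rw [complexity_C_holds]
        refine Nat.add_le_add_right (Nat.add_le_add (Nat.zero_le _) ?_) 1
        refine (complexity_finset_prod_le _ _).trans ?_
        rw [Finset.sum_eq_zero fun l _ => complexity_X_holds _, zero_add, Finset.card_univ,
          Fintype.card_fin]
  choose B hBsum hBdeg hBcx using hB
  -- Step 4: `(HC_{t n}(B̃_n))_n ∈ VNP` and its Boolean sum
  have hHC : IsVNPFamily (σ := fun n => Fin (t n) × Fin (t n)) fun n => hcPoly (Fin (t n)) k :=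
    (isVNPFamily_hcPoly_holds k).reindex ht
  have hinner : IsVNPFamily fun n => MvPolynomial.aeval
      (fun q : Fin (t n) × Fin (t n) =>
        rename (Sum.map id fun l : Fin (u n) => finProdFinEquiv (q.2, l)) (B n q))
      (hcPoly (Fin (t n)) k) := by
    refine hHC.aeval _ ((IsPBounded.add_holds hτ (IsPBounded.mul_holds ht hu)).mono fun n => by
        rw [Fintype.card_sum, Fintype.card_fin])
      ((IsPBounded.add_holds hGd hu).mono fun n => Finset.sup_le fun q _ =>
        (totalDegree_rename_le _ _).trans (hBdeg n q))
      ((IsPBounded.mul_holds (IsPBounded.mul_holds ht ht) (IsPBounded.add_holds hGc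
        (IsPBounded.add_holds hu (IsPBounded.const 1)))).mono fun n => ?_)
    calc ∑ q : Fin (t n) × Fin (t n), complexity
          (rename (Sum.map id fun l : Fin (u n) => finProdFinEquiv (q.2, l)) (B n q))
        ≤ ∑ _q : Fin (t n) × Fin (t n), ((∑ i, complexity (G n i)) + (u n + 1)) :=
          Finset.sum_le_sum fun q _ => (complexity_rename_le_holds' _ _).trans (hBcx n q)
      _ = t n * t n * ((∑ i, complexity (G n i)) + (u n + 1)) := by
          rw [Finset.sum_const, Finset.card_univ, Fintype.card_prod, Fintype.card_fin, smul_eq_mul]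
  have hVNP := IsVNPFamily.boolSum hinner
  -- Step 5: identify the Boolean sum with `f_n(g_n)`
  refine (iff_of_eq (congrArg IsVNPFamily (funext fun n => ?_))).1 hVNP
  have h2 : (fun q => boolSum (B n q)) = fun q => MvPolynomial.aeval (g' n) (a n q) :=
    funext (hBsum n)
  have h3 : MvPolynomial.aeval (fun q => MvPolynomial.aeval (g' n) (a n q)) (hcPoly (Fin (t n)) k) =
      MvPolynomial.aeval (g' n) (MvPolynomial.aeval (a n) (hcPoly (Fin (t n)) k)) := by
    rw [← AlgHom.comp_apply, comp_aeval]
  have h4 : MvPolynomial.aeval (g' n) (rename (e n) (f n)) =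
      MvPolynomial.aeval (fun i => boolSum (G n i)) (f n) := by
    rw [aeval_rename]
    have hfun : (g' n ∘ e n) = fun i => boolSum (G n i) := by
      funext i
      show boolSum (G n ((e n).symm (e n i))) = boolSum (G n i)
      rw [Equiv.symm_apply_apply]
    rw [hfun]
  calc boolSum (MvPolynomial.aeval (fun q : Fin (t n) × Fin (t n) =>
          rename (Sum.map id fun l : Fin (u n) => finProdFinEquiv (q.2, l)) (B n q))
          (hcPoly (Fin (t n)) k))
      = MvPolynomial.aeval (fun q => boolSum (B n q)) (hcPoly (Fin (t n)) k) :=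
        (aeval_boolSum_hcPoly (B n)).symm
    _ = MvPolynomial.aeval (g' n) (MvPolynomial.aeval (a n) (hcPoly (Fin (t n)) k)) := by rw [h2, h3]
    _ = MvPolynomial.aeval (g' n) (rename (e n) (f n)) := by
        have hfa' : rename (e n) (f n) = MvPolynomial.aeval (a n) (hcPoly (Fin (t n)) k) := hfa n
        rw [hfa']
    _ = MvPolynomial.aeval (fun i => boolSum (G n i)) (f n) := h4

/-- **`VNP` is closed under composition with uniformly p-definable tuples (`VNP ∘ VNP ⊆ VNP`)**
(Bürgisser 2024, §3.1), arbitrary block sizes: if `(f_n) ∈ VNP`, `f_n ∈ k[ρ_n]`, and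
`g_{n,i} = Σ_{e ∈ {0,1}^{u(n,i)}} G_{n,i}(X, e)` with `#τ_n`, `max_i u(n,i)`, `max_i deg G_{n,i}` and
`Σ_i L(G_{n,i})` p-bounded, then `(f_n(g_n))_n ∈ VNP` — pad every block to the largest one
(`boolSum_pad`) and apply `isVNPFamily_aeval_boolSum_uniform`.
[cite: Burgisser2024Completeness, §3.1 (p0013 L10–L15)] [cite: Burgisser2000, Thm. 2.10] -/
theorem isVNPFamily_aeval_boolSum {f : ∀ n, MvPolynomial (ρ n) k} (hf : IsVNPFamily f)
    {u : ∀ n, ρ n → ℕ} (G : ∀ n (i : ρ n), MvPolynomial (τ n ⊕ Fin (u n i)) k)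
    (hτ : IsPBounded fun n => Fintype.card (τ n)) (hu : IsPBounded fun n => Finset.univ.sup (u n))
    (hGd : IsPBounded fun n => Finset.univ.sup fun i => (G n i).totalDegree)
    (hGc : IsPBounded fun n => ∑ i, complexity (G n i)) :
    IsVNPFamily fun n => MvPolynomial.aeval (fun i => boolSum (G n i)) (f n) := by
  classical
  have hρ : IsPBounded fun n => Fintype.card (ρ n) := hf.1.1
  have hle : ∀ n i, u n i ≤ Finset.univ.sup (u n) := fun n i =>
    Finset.le_sup (f := u n) (Finset.mem_univ i)
  -- the padded witnesses
  let G' : ∀ n, ρ n → MvPolynomial (τ n ⊕ Fin (Finset.univ.sup (u n))) k := fun n i =>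
    rename (Sum.map id (Fin.castLE (hle n i))) (G n i) *
      ∏ l ∈ Finset.univ.filter (fun l : Fin (Finset.univ.sup (u n)) => u n i ≤ (l : ℕ)),
        X (Sum.inr l)
  have hG' : ∀ n i, boolSum (G' n i) = boolSum (G n i) := fun n i => boolSum_pad (hle n i) (G n i)
  have h := isVNPFamily_aeval_boolSum_uniform hf G' hτ hu
    ((IsPBounded.add_holds hGd hu).mono fun n => Finset.sup_le fun i _ => ?_)
    ((IsPBounded.add_holds hGc (IsPBounded.mul_holds hρ
      (IsPBounded.add_holds hu (IsPBounded.const 1)))).mono fun n => ?_)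
  · refine (iff_of_eq (congrArg IsVNPFamily (funext fun n => ?_))).1 h
    simp only [hG']
  · -- degrees of the padded witnesses
    refine (totalDegree_mul _ _).trans (Nat.add_le_add ((totalDegree_rename_le _ _).trans
      (Finset.le_sup (f := fun i => (G n i).totalDegree) (Finset.mem_univ i))) ?_)
    refine (totalDegree_finsetProd _ _).trans ?_
    refine (Finset.sum_le_sum fun l _ => mvPolynomial_totalDegree_X_le_one (Sum.inr l)).trans ?_
    rw [Finset.sum_const, smul_eq_mul, mul_one]
    exact (Finset.card_filter_le _ _).trans (by rw [Finset.card_univ, Fintype.card_fin])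
  · -- sizes of the padded witnesses
    calc ∑ i, complexity (G' n i)
        ≤ ∑ i, (complexity (G n i) + (Finset.univ.sup (u n) + 1)) :=
          Finset.sum_le_sum fun i _ => by
            refine (complexity_mul_le_holds _ _).trans (Nat.add_le_add_right (Nat.add_le_add
              (complexity_rename_le_holds' _ _) ?_) 1)
            refine (complexity_finset_prod_le _ _).trans ?_
            rw [Finset.sum_eq_zero fun l _ => complexity_X_holds _, zero_add]
            exact (Finset.card_filter_le _ _).trans (by rw [Finset.card_univ, Fintype.card_fin])
      _ = (∑ i, complexity (G n i)) + Fintype.card (ρ n) * (Finset.univ.sup (u n) + 1) := by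
          rw [Finset.sum_add_distrib, Finset.sum_const, Finset.card_univ, smul_eq_mul]

end Definable

/-! ## The survey's literal form: composing two p-families -/

section Literal

/-- The maximum of the first `v(n)` values of a p-bounded function, `v` p-bounded, is p-bounded.
[cite: Burgisser2000, Def. 2.1(1)] -/
theorem IsPBounded.sup_fin {s v : ℕ → ℕ} (hs : IsPBounded s) (hv : IsPBounded v) :
    IsPBounded fun n => Finset.univ.sup fun i : Fin (v n) => s i := by
  obtain ⟨c, hc⟩ := hs
  refine (IsPBounded.comp_holds (s := fun m => m ^ c + c) ⟨c, fun n => le_rfl⟩ hv).mono fun n => ?_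
  refine Finset.sup_le fun i _ => (hc i).trans ?_
  exact Nat.add_le_add_right (Nat.pow_le_pow_left i.is_lt.le c) c

/-- The sum of the first `v(n)` values of a p-bounded function, `v` p-bounded, is p-bounded.
[cite: Burgisser2000, Def. 2.1(1)] -/
theorem IsPBounded.sum_fin {s v : ℕ → ℕ} (hs : IsPBounded s) (hv : IsPBounded v) :
    IsPBounded fun n => ∑ i : Fin (v n), s i := by
  refine (IsPBounded.mul_holds hv (hs.sup_fin hv)).mono fun n => ?_
  calc ∑ i : Fin (v n), s i ≤ ∑ _i : Fin (v n), Finset.univ.sup (fun i : Fin (v n) => s i) :=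
        Finset.sum_le_sum fun i _ => Finset.le_sup (f := fun i : Fin (v n) => s i) (Finset.mem_univ i)
    _ = v n * Finset.univ.sup (fun i : Fin (v n) => s i) := by
        rw [Finset.sum_const, Finset.card_univ, Fintype.card_fin, smul_eq_mul]

variable {k : Type u}

/-- **`VP` is closed under composition, as printed** (Bürgisser 2024, §3.1): for `p`-computable
families `(f_n)`, `f_n ∈ k[X_0, …, X_{v(n)-1}]`, and `(g_n)`, `g_n ∈ k[X_0, …, X_{w(n)-1}]`, the
composite family `(f_n(g_0, …, g_{v(n)-1}))_n` — the members `g_0, …, g_{v(n)-1}` read in a common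
polynomial ring `k[X_0, …, X_{W(n)-1}]`, `w(i) ≤ W(n)` for `i < v(n)`, `W` p-bounded — is
`p`-computable. [cite: Burgisser2024Completeness, §3.1 (p0013 L10–L15)] -/
theorem IsVPFamily.comp [CommRing k] {v w : ℕ → ℕ} {f : ∀ n, MvPolynomial (Fin (v n)) k}
    {g : ∀ n, MvPolynomial (Fin (w n)) k} (hf : IsVPFamily f) (hg : IsVPFamily g) {W : ℕ → ℕ}
    (hW : ∀ n (i : Fin (v n)), w i ≤ W n) (hWp : IsPBounded W) :
    IsVPFamily fun n =>
      MvPolynomial.aeval (fun i : Fin (v n) => rename (Fin.castLE (hW n i)) (g i)) (f n) := by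
  have hv : IsPBounded v := hf.1.1.mono fun n => by rw [Fintype.card_fin]
  obtain ⟨⟨_, hgd⟩, hgc⟩ := hg
  refine hf.aeval _ (hWp.mono fun n => by rw [Fintype.card_fin]) ?_ ?_
  · exact (hgd.sup_fin hv).mono fun n => Finset.sup_le fun i _ => (totalDegree_rename_le _ _).trans
      (Finset.le_sup (f := fun i : Fin (v n) => (g i).totalDegree) (Finset.mem_univ i))
  · exact (hgc.sum_fin hv).mono fun n => Finset.sum_le_sum fun i _ => complexity_rename_le_holds' _ _

/-- **`VNP` is closed under composition, as printed** (Bürgisser 2024, §3.1): for `p`-definable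
families `(f_n)`, `f_n ∈ k[X_0, …, X_{v(n)-1}]`, and `(g_n)`, `g_n ∈ k[X_0, …, X_{w(n)-1}]`, the
composite family `(f_n(g_0, …, g_{v(n)-1}))_n` (members read in `k[X_0, …, X_{W(n)-1}]`, `W`
p-bounded) is `p`-definable — `isVNPFamily_aeval_boolSum` with the `VP` witnesses of `g_0, …,
g_{v(n)-1}` as inner data (their sizes, degrees and Boolean block lengths are bounded by p-bounded
functions of `i < v(n)`, hence of `n`: `IsPBounded.sup_fin`, `IsPBounded.sum_fin`).
[cite: Burgisser2024Completeness, §3.1 (p0013 L10–L15)] [cite: Burgisser2000, Thm. 2.10] -/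
theorem IsVNPFamily.comp [Field k] {v w : ℕ → ℕ} {f : ∀ n, MvPolynomial (Fin (v n)) k}
    {g : ∀ n, MvPolynomial (Fin (w n)) k} (hf : IsVNPFamily f) (hg : IsVNPFamily g) {W : ℕ → ℕ}
    (hW : ∀ n (i : Fin (v n)), w i ≤ W n) (hWp : IsPBounded W) :
    IsVNPFamily fun n =>
      MvPolynomial.aeval (fun i : Fin (v n) => rename (Fin.castLE (hW n i)) (g i)) (f n) := by
  classical
  have hv : IsPBounded v := hf.1.1.mono fun n => by rw [Fintype.card_fin]
  obtain ⟨-, ug, Gg, ⟨⟨Ggv, Ggd⟩, Ggc⟩, hgG⟩ := hg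
  have hug : IsPBounded ug := Ggv.mono fun n => by simp [Fintype.card_sum]
  have key := isVNPFamily_aeval_boolSum (τ := fun n => Fin (W n)) hf
    (u := fun n (i : Fin (v n)) => ug i)
    (fun n i => rename (Sum.map (Fin.castLE (hW n i)) id) (Gg i))
    (hWp.mono fun n => by rw [Fintype.card_fin]) (hug.sup_fin hv)
    ((Ggd.sup_fin hv).mono fun n => Finset.sup_le fun i _ => (totalDegree_rename_le _ _).trans
      (Finset.le_sup (f := fun i : Fin (v n) => (Gg i).totalDegree) (Finset.mem_univ i)))
    ((Ggc.sum_fin hv).mono fun n => Finset.sum_le_sum fun i _ => complexity_rename_le_holds' _ _)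
  refine (iff_of_eq (congrArg IsVNPFamily (funext fun n => ?_))).1 key
  have hfun : (fun i : Fin (v n) => _root_.Literature.Computability.AlgebraicComplexity.boolSum
        (rename (Sum.map (Fin.castLE (hW n i)) id) (Gg i))) =
      fun i : Fin (v n) => rename (Fin.castLE (hW n i)) (g i) := by
    funext i
    rw [boolSum_rename_sumMap, ← hgG i]
  rw [hfun]

end Literal

/-! ## `VF = VP_e` (p-bounded formula size) is closed under composition -/

section Formulas

variable {k : Type u} [CommSemiring k]

/-- `E(X_j) = 0` (a leaf; re-derived from the `WExpr` bridge to keep imports light).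
[cite: BurgisserClausenShokrollahi1997, (21.19)] -/
private theorem formulaComplexity_X_le_zero' {σ : Type v} (j : σ) :
    formulaComplexity (X j : MvPolynomial σ k) ≤ 0 :=
  (exists_wexpr_iff_formulaComplexity_le _ 0).mp ⟨.var j, WExpr.eval_var j, le_rfl⟩

/-- `E(rename ι h) ≤ E(h)`: relabelling leaves is free (the tree's
`formulaComplexity_rename_le` of the Andrews–Forbes files, re-derived to keep imports light).
[cite: BurgisserClausenShokrollahi1997, §21.1 p. 549] -/
private theorem formulaComplexity_rename_le' {σ : Type v} {τ : Type w} (ι : σ → τ)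
    (h : MvPolynomial σ k) : formulaComplexity (rename ι h) ≤ formulaComplexity h := by
  have hre : rename ι h = bind₁ (fun i => (X (ι i) : MvPolynomial τ k)) h := by
    refine AlgHom.congr_fun (MvPolynomial.algHom_ext fun i => ?_) h
    simp only [rename_X, bind₁_X_right]
  rw [hre]
  refine (formulaComplexity_bind₁_le (B := 0) (fun i => formulaComplexity_X_le_zero' (ι i)) h).trans
    ?_
  omega

variable {ρ : ℕ → Type v} {τ : ℕ → Type w} [∀ n, Fintype (ρ n)]

/-- **`VF` is closed under composition** (substitution form; Bürgisser 2024, §3.1, the class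
`VF = VP_e` of families of p-bounded formula size): if `E(f_n)` is p-bounded and the tuples
`g_n = (g_{n,i})_i` have p-bounded `max_i E(g_{n,i})`, then `E(f_n(g_n))` is p-bounded —
`E(f(g)) ≤ E(f) + (E(f) + 1) · max_i E(g_i)` (substitute formulas at the leaves,
`formulaComplexity_bind₁_le`). [cite: Burgisser2024Completeness, §3.1 (p0013 L10–L15)] -/
theorem isPBounded_formulaComplexity_aeval {f : ∀ n, MvPolynomial (ρ n) k}
    (hf : IsPBounded fun n => formulaComplexity (f n)) (g : ∀ n, ρ n → MvPolynomial (τ n) k)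
    (hg : IsPBounded fun n => Finset.univ.sup fun i => formulaComplexity (g n i)) :
    IsPBounded fun n => formulaComplexity (MvPolynomial.aeval (g n) (f n)) := by
  refine (IsPBounded.add_holds hf (IsPBounded.mul_holds (IsPBounded.add_holds hf
    (IsPBounded.const 1)) hg)).mono fun n => ?_
  change formulaComplexity (bind₁ (g n) (f n)) ≤ _
  exact formulaComplexity_bind₁_le
    (fun i => Finset.le_sup (f := fun i => formulaComplexity (g n i)) (Finset.mem_univ i)) (f n)

/-- **`VF` is closed under composition, as printed** (Bürgisser 2024, §3.1): for families
`(f_n)`, `f_n ∈ k[X_0, …, X_{v(n)-1}]` with `v` and `E(f_n)` p-bounded, and `(g_n)`,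
`g_n ∈ k[X_0, …, X_{w(n)-1}]` with `E(g_n)` p-bounded, the composite
`(f_n(g_0, …, g_{v(n)-1}))_n` (members read in a common `k[X_0, …, X_{W(n)-1}]`) has p-bounded
formula size. [cite: Burgisser2024Completeness, §3.1 (p0013 L10–L15)] -/
theorem isPBounded_formulaComplexity_comp {v w : ℕ → ℕ} {f : ∀ n, MvPolynomial (Fin (v n)) k}
    {g : ∀ n, MvPolynomial (Fin (w n)) k} (hv : IsPBounded v)
    (hf : IsPBounded fun n => formulaComplexity (f n))
    (hg : IsPBounded fun n => formulaComplexity (g n)) {W : ℕ → ℕ}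
    (hW : ∀ n (i : Fin (v n)), w i ≤ W n) :
    IsPBounded fun n => formulaComplexity
      (MvPolynomial.aeval (fun i : Fin (v n) => rename (Fin.castLE (hW n i)) (g i)) (f n)) :=
  isPBounded_formulaComplexity_aeval hf _ ((hg.sup_fin hv).mono fun n => Finset.sup_le
    fun i _ => (formulaComplexity_rename_le' _ _).trans
      (Finset.le_sup (f := fun i : Fin (v n) => formulaComplexity (g i)) (Finset.mem_univ i)))

end Formulas

end Literature.Computability.AlgebraicComplexity

end
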